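import Summits.SmoothPoincare4.SmoothPoincare4.Theses.VerlindeRLinks
import Literature.Topology.FourManifolds.RLinkSphere
import Literature.Topology.FourManifolds.KirbyCalculusUnlinkProofs
import Literature.Barriers.SmoothPoincare4.PropertyTwoRAndrewsCurtisLink
import HarnessLib.Audit

/-!
# `VrlSliceRigidity` — negative-side support for the picked line `sphere_split` (targets)

Crux `Summit.SmoothPoincare4.SmoothPoincare4.Theses.VerlindeRLinks.VrlSliceRigidity`
(stmt-SmoothPoincare4-16179); line `Cruxes/VrlSliceRigidity/Lines/sphere_split.lean` (picked
2026-08-17), stubs `stub_sphereExists` (known), `stub_sliceSphereStandard`, `stub_stdSphereSlides`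
— restated INLINE below, verbatim from the line file (`Sig.stub_*`), which is not an importable
module.  From the standing disprover's work file `Cruxes/VrlSliceRigidity/Disproof.lean` §5.

* `not_stdSphereSlides_of_acNontrivial` — the heart stub (GPRC on the STANDARD sphere: an R-link
  whose closed `1`-handle-free manifold `Σ_L` is diffeomorphic to `S⁴` strictly slides to a
  `0`-framed unlink) is FALSE GIVEN (i) GST's link with standard sphere — for every `n` an R-link
  `L : FramedLink (Fin 2)` (GST's `L_{n,1}`) with SOME `X`, `IsRLinkSphere X L`, diffeomorphic to
  `S⁴` (Gompf 1991 [Go1]: the Akbulut–Kirby sphere is standard; GST 2010 §7 and §8 p. 18: "the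
  pictured 4-manifold is actually diffeomorphic to a 4-ball [Go1]"), whose strict slide-triviality
  forces Andrews–Curtis triviality of `gstPresentation n` (§7 p. 17) — hypothesis `hGo`, inline —
  and (ii) `AKPresentationsACNontrivial` (open).  So the stub carries the ENTIRE Andrews–Curtis
  content of the crux, located unconditionally (no open ribbon question as in line `birth`).
* `sliceSphereStandard_zero_of` — the `n = 0` instance of `stub_sliceSphereStandard` already says
  that EVERY closed manifold of the empty R-link, i.e. every twisted sphere `P ∪_φ V` (`P` a trace
  of `∅`, `V` a `(1,0)`-handlebody, `φ` ANY diffeomorphism of the boundary `3`-spheres), is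
  diffeomorphic to `S⁴` — on paper Cerf's `Γ₄ = 0`; a COST WARNING for the lead (the stub is
  implied by `SmoothPoincare4` via the proved `IsRLinkSphere.nonempty_homotopyEquiv_sphere_holds`,
  so it cannot be refuted short of an exotic `S⁴`).

No definition and no named fact is introduced; nothing uses `sorry`.
References: [GompfScharlemannThompson2010, §7 (arXiv p. 17), §8 (arXiv p. 18), §9];
[Gompf1991Killing]; [Cerf1968]; [Kirby1989, Ch. I §2].
-/

noncomputable section

-- The namespace is prescribed by the crux protocol (`Summit.<P>.<Sub>.Theorems.<Crux>.Negative`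
-- with `P = Sub = SmoothPoincare4`), hence the duplicated component.
set_option linter.dupNamespace false

namespace Summit.SmoothPoincare4.SmoothPoincare4.Theorems.VrlSliceRigidity.Negative

open scoped Manifold ContDiff
open Literature.Topology.FourManifolds
open Literature.Barriers.SmoothPoincare4 (gstPresentation AKPresentationsACNontrivial)

/-- **The heart stub `stub_stdSphereSlides` is false given GST's standard-sphere link and
Andrews–Curtis nontriviality**: apply the stub to `L_{n,1}` and Gompf's `Σ_{L_{n,1}} ≅ S⁴`; the
strict slides to a `0`-framed unlink make `gstPresentation n` Andrews–Curtis trivial.  (The stub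
statement is the verbatim `Sig.stub_stdSphereSlides` of `Lines/sphere_split.lean`.)
[cite: GompfScharlemannThompson2010, §7 (arXiv p. 17) and §8 (arXiv p. 18)] [cite: Gompf1991Killing] -/
theorem not_stdSphereSlides_of_acNontrivial [Knot.TubularNbhd.SmoothnessFacts]
    (hGo : ∀ n : ℕ, ∃ L : FramedLink (Fin 2),
      (∃ (Y : Type) (_ : TopologicalSpace Y) (_ : T2Space Y) (_ : SecondCountableTopology Y)
          (_ : ChartedSpace (EuclideanSpace ℝ (Fin 3)) Y) (_ : IsManifold (𝓡 3) ∞ Y)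
          (_ : CompactSpace Y) (_ : ConnectedSpace Y),
          IsSphereTwoProdCircleSum 2 Y ∧ L.IsSurgery (𝓡 3) Y) ∧
      (∃ (X : Type) (_ : TopologicalSpace X) (_ : T2Space X) (_ : SecondCountableTopology X)
          (_ : ChartedSpace (EuclideanSpace ℝ (Fin 4)) X) (_ : IsManifold (𝓡 4) ∞ X),
          IsRLinkSphere X L ∧
            Nonempty (X ≃ₘ⟮𝓡 4, 𝓡 4⟯ Metric.sphere (0 : EuclideanSpace ℝ (Fin 5)) 1)) ∧
      ∀ U : FramedLink (Fin 2), U.IsZeroFramedUnlink →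
        IsStrictHandleSlideEquivalent ⟨2, L⟩ ⟨2, U⟩ →
          IsAndrewsCurtisEquivalent (gstPresentation n) (BalancedPresentation.trivial 2))
    (hAC : AKPresentationsACNontrivial) :
    ¬ ∀ [Knot.TubularNbhd.SmoothnessFacts] (n : ℕ) (L : FramedLink (Fin n)) (Y : Type)
        [TopologicalSpace Y] [T2Space Y] [SecondCountableTopology Y]
        [ChartedSpace (EuclideanSpace ℝ (Fin 3)) Y] [IsManifold (𝓡 3) ∞ Y] [CompactSpace Y]
        [ConnectedSpace Y],
        IsSphereTwoProdCircleSum n Y → L.IsSurgery (𝓡 3) Y →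
          ∀ (X : Type) [TopologicalSpace X] [T2Space X] [SecondCountableTopology X]
            [ChartedSpace (EuclideanSpace ℝ (Fin 4)) X] [IsManifold (𝓡 4) ∞ X],
            IsRLinkSphere X L →
              Nonempty (X ≃ₘ⟮𝓡 4, 𝓡 4⟯ Metric.sphere (0 : EuclideanSpace ℝ (Fin 5)) 1) →
                ∃ U : FramedLink (Fin n), U.IsZeroFramedUnlink ∧
                  IsStrictHandleSlideEquivalent ⟨n, L⟩ ⟨n, U⟩ := by
  intro h2
  obtain ⟨n, -, hnot⟩ := hAC
  obtain ⟨L, ⟨Y, _, _, _, _, _, _, _, hY, hL⟩, ⟨X, _, _, _, _, _, hX, hstd⟩, hACtriv⟩ := hGo n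
  obtain ⟨U, hU, hLU⟩ := @h2 ‹_› 2 L Y _ _ _ _ _ _ _ hY hL X _ _ _ _ _ hX hstd
  exact hnot (hACtriv U hU hLU)

/-- **The `n = 0` instance of `stub_sliceSphereStandard` is the standardness of ALL twisted
spheres**: from the stub (verbatim `Sig.stub_sliceSphereStandard`), every `X` with
`IsRLinkSphere X FramedLink.empty` — a gluing `P ∪_φ V` of a trace of the empty link and a
`(1,0)`-handlebody along an ARBITRARY boundary diffeomorphism `φ` — is diffeomorphic to `S⁴`
(apply the stub to the empty link and `Y = S³`, the PROVED surgery on the empty link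
`FramedLink.isSurgery_sphereThree_of_isEmpty`).  On paper this is Cerf's `Γ₄ = 0`; recorded as
the typed cost already hidden in the stub at `n = 0`. [cite: Kirby1989, Ch. I §2] -/
theorem sliceSphereStandard_zero_of
    (h : ∀ (n : ℕ) (L : FramedLink (Fin n)) (Y : Type) [TopologicalSpace Y] [T2Space Y]
        [SecondCountableTopology Y] [ChartedSpace (EuclideanSpace ℝ (Fin 3)) Y]
        [IsManifold (𝓡 3) ∞ Y] [CompactSpace Y] [ConnectedSpace Y],
        IsSphereTwoProdCircleSum n Y → L.IsSurgery (𝓡 3) Y →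
          (∀ i : Fin n, (L.component i).IsSmoothlySlice) →
            ∀ (X : Type) [TopologicalSpace X] [T2Space X] [SecondCountableTopology X]
              [ChartedSpace (EuclideanSpace ℝ (Fin 4)) X] [IsManifold (𝓡 4) ∞ X],
              IsRLinkSphere X L →
                Nonempty (X ≃ₘ⟮𝓡 4, 𝓡 4⟯ Metric.sphere (0 : EuclideanSpace ℝ (Fin 5)) 1))
    (X : Type) [TopologicalSpace X] [T2Space X] [SecondCountableTopology X]
    [ChartedSpace (EuclideanSpace ℝ (Fin 4)) X] [IsManifold (𝓡 4) ∞ X]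
    (hX : IsRLinkSphere X FramedLink.empty) :
    Nonempty (X ≃ₘ⟮𝓡 4, 𝓡 4⟯ Metric.sphere (0 : EuclideanSpace ℝ (Fin 5)) 1) := by
  haveI : ConnectedSpace (Metric.sphere (0 : EuclideanSpace ℝ (Fin 4)) 1) :=
    connectedSpace_sphere_succ 2
  exact h 0 FramedLink.empty (Metric.sphere (0 : EuclideanSpace ℝ (Fin 4)) 1)
    ⟨Diffeomorph.refl _ _ _⟩ (FramedLink.isSurgery_sphereThree_of_isEmpty _) (fun i ↦ i.elim0) X hX

end Summit.SmoothPoincare4.SmoothPoincare4.Theorems.VrlSliceRigidity.Negative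

end
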